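import Mathlib
import Literature.MathematicalPhysics.QuantumFieldTheory.Balaban1983to89.B10
import Literature.MathematicalPhysics.QuantumFieldTheory.Balaban1983to89.B13
import Literature.MathematicalPhysics.QuantumFieldTheory.Balaban1983to89.B13Sqrt27
import Literature.MathematicalPhysics.QuantumFieldTheory.Balaban1983to89.B9Thm37Sum
import Literature.MathematicalPhysics.QuantumFieldTheory.Balaban1983to89.Beta.GaussianIntegral

/-!
# `Balaban1983to89.B10LogDet63` — [Balaban1985UV3] (61)–(63) pp. 271–272: the "log Z^{(k)} half" of the inductive
# step — the log-determinant / resolvent calculus of (63) at OPERATOR level, the (61) difference, and the bookkeeping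
# *"Summing the expressions with the same localization X"* (p. 262) that turns walk terms into the per-cube shape
# `B13.LogHalfBound`, kernel-checked

T. Bałaban, *Ultraviolet stability of three-dimensional lattice pure gauge field theories*, Commun. Math. Phys. **102**,
255–275 (1985) [Balaban1985UV3] (cell paper B10; PDF `paper:balaban1985-cmp102-uv-stability-3d`, journal page = PDF
page + 254).  Sibling of `…Balaban1983to89.B10` (the typed skeleton of the paper, whose `logdet63_skeleton` is the
ONE-EIGENVALUE identity behind (63)); consumed by the d = 4 cluster-expansion paper through `…Balaban1983to89.B13`
(`B13.LogHalfBound`, the per-LM-cube log Z^{(k)} leaf of [Balaban1988RG2Cluster] p. 21: *"The expansion was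
constructed in [16], see the formula (63) there, and the discussion after it"* — [16] = this paper).

v1.1 (DOCFIX of v1 = p179276: the quotations of (23), (25) p. 262 and of the p. 271 paragraph re-checked word by
word against the renders p008/p017 — (23) now printed in full, (25) reads `O(g₀)`, the quadratic form is printed
`⟨A, C*Δ_kCA⟩`; no declaration changed).

CITATION HEADER (lean-in-tree rule).  WHAT IS REPRODUCED, verbatim from the renders of pp. 271–272 [PDF 17–18] and
p. 262 [PDF 8], in the docstrings below: the additional term (61); the Gaussian-integral paragraph of p. 271; display
(63) AS PRINTED together with the cell's recorded reading of its misprints (DIVERGENCE D-adv2-1 / D-b10.2, GAPS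
G-adv2-9: in the sentence before (63) the circle is printed `|z| = γ₁` and the cut `[2γ₁, 0]` — (63) itself integrates
over `|z| = 2γ₁`, and the cut is `[−2γ₁, 0]`; the middle term `−½C*Δ_kC` of (63) stands for `−½ log(2γ₁)·Tr I`; a `Tr`
is missing in the last sum); the two paragraphs of p. 272 on the random-walk representation of `G̃₃(x)` and the
cancellation at `U_{k+1} = 1`; the walk-term bound (23) and the sentences *"Summing the expressions with the same
localization X …"*, (25) *"where κ can be arbitrarily large if M₁ is sufficiently large"* of p. 262.

WHAT IS KERNEL-CERTIFIED (theorems about real symmetric matrices, real integrals and finite sums — no object of the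
series is constructed):
* §1–§2 — (63) at operator level: for a positive definite real symmetric `T` with every eigenvalue `≤ γ₁` (*"The number
  γ₁ is an upper bound of the positive, bounded operator C*Δ_kC"*),
  `−½ log det T = ½∫₀^{2γ₁} dx Tr(T + xI)⁻¹ − ½ log(2γ₁)·Tr I + Σ_{n≥1} ((−1)ⁿ/2n)(2γ₁)⁻ⁿ Tr Tⁿ`
  (`matrix63`, the series as a `HasSum`: `hasSum_matrix63`; under a form bound `⟨v,Tv⟩ ≤ γ₁‖v‖²`: `matrix63_of_form_le`)
  — i.e. the CORRECTED reading of the printed display is a theorem and the cell's misprint record is confirmed at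
  operator level (the one-eigenvalue identity is `B10.logdet63_skeleton` + the logarithmic series, `hasSum_scalar63`);
  the (61) DIFFERENCE of two such expansions with a common `γ₁`, in which the constant `−½ log(2γ₁)·Tr I` cancels
  (`diff61_split`), and — the form in which the x-uniformity question GAPS G-B10-06 (ii) / G-IF-10 is posed — the
  whole-half-line identity `log det T₁ − log det T₀ = ∫₀^∞ [Tr(T₀ + x)⁻¹ − Tr(T₁ + x)⁻¹] dx` with an integrable
  integrand (`diff61_Ioi`); the Gaussian normalisation sentence of p. 271 (*"Its logarithm is equal to a sum of an
  absolute constant, cancelled by the same constant from the second term in (61), and the expression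
  ½ log det(C*Δ_kC)⁻¹"*) for the unconstrained Gaussian integral in the variables Ã (`log_gaussian_diff61`, from the
  tree's `Beta.GaussianIntegral.log_integral_exp_neg_half_quadForm`).
* §3 — the LOCALISATION BOOKKEEPING, d-independent and abstract (cubes `Q` with ≤ `Dg` neighbours each, sites `S` with
  ≤ `V` per cube, walks = the tree's `B9Thm37Sum.walksFrom`, an abstract system of localization domains
  `LocDomainSys` with a domain `dom b ω` assigned to each walk term): IF the walk terms obey the printed bound (23) in the
  abstract form `|term b ω| ≤ K·q^{|ω|}·exp(−r d(dom b ω))` on the analyticity space of their domain, and `Dg·q < 1`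
  (*"We will use the factor O(M^{−1/2}) to control the sum over random walks"*, [5] p. 410), THEN the regrouped terms
  `Elog X := Σ_n Σ_b Σ_{ω : dom b ω = X} term b ω` obey `B13.LogHalfBound D sp Elog (#cubes) B r` with the SAME rate and
  `B = K·V/(1 − Dg·q)` (`logHalfBound_of_walks`; levels `norm_level_le`, summability `summable_level`, the resummation
  identity `sum_Elog_eq`); the variant with per-step decay only (`logHalfBound_of_walks_linear`, the mechanism of (25));
  the x-integrated version for the first term of (63) (`logHalfBound_integral63`: an x-UNIFORM bound on `[0, 2γ₁]`
  costs exactly the factor `2γ₁`); and the DICHOTOMY of cell GAPS G-B13-12a made structural (`logHalfBound_perSite`):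
  the per-cube constant is `(K₀/(1 − Dg·q))·θ·V` when the per-term constant factors as `K₀·θ` — reading (a)
  (`B = A·θ·(LM)^d`) iff the difference terms carry a per-site smallness θ, reading (b) (`B = A·(LM)^d`) otherwise.
  Shape algebra: `logHalfBound_mono/add/smul/sub`.

WHAT IS NOT CERTIFIED (named leaves, hypotheses of the theorems; cell GAPS rows in brackets): that `G̃₃(x)` HAS a
generalized random walk expansion with (23)-type bounds UNIFORM in `x ∈ [0, 2γ₁]` (*"The operator G̃₃(x) has the same
properties as G̃₂, especially it can be represented by a generalized random walk expansion"* — asserted by analogy;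
[G-B10-06, G-IF-10]; typed as the hypothesis `G3WalkBound`); the upper bound `γ₁` itself [C-IF-07 (E2), kernel
`B9SectEKernel.form_sandwich_le` under its hypotheses]; which smallness θ the difference terms carry [G-B13-12a,
G-adv5-5]; the elimination of the δ-functions `A = CÃ` ([5] Sect. E) and the local terms `−log det S(V_k^{(k)}, b₀(c))` it
produces (p. 271, (124) [4]); gauge invariance and analyticity of the terms;
the identification of the abstract `LocDomainSys`, cubes, sites and tree length with the paper's (DIVERGENCE F5 —
the instantiation for a window of ℤ^d is `…TreeLengthCubeSystem`).  The weighted-norm algebra of [Balaban1988RG2Cluster]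
(2.15)–(2.17) (perturbed inverses localised at the same rate) is the business of the sibling `…B13PerturbativeStep`
and is not duplicated here.  Value = kernel certificate of the printed operator calculus + located leaves, NOT summit
progress; d = 3 in the paper, every statement here is d-independent.

## References
* [Balaban1985UV3] T. Bałaban, Commun. Math. Phys. 102 (1985) 255–275, (23)–(25) p. 262, (61)–(63) pp. 271–272.
* [Balaban1985BackgroundPropagators] T. Bałaban, Commun. Math. Phys. 99 (1985) 389–434 (= [5] of the paper),
  (3.108), (3.156), (3.183)–(3.185), p. 410.
* [Balaban1988RG2Cluster] T. Bałaban, Commun. Math. Phys. 116 (1988) 1–22, p. 21 (the consumer of (63) for d = 4).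
-/

noncomputable section

open MeasureTheory Set Filter Matrix Finset
open scoped Real Topology

namespace Literature.MathematicalPhysics.QuantumFieldTheory.Balaban1983to89.B10LogDet63

open Literature.MathematicalPhysics.QuantumFieldTheory.Balaban1983to89

/-! ## §0. The printed text (pp. 271–272, 262) — quoted; the one unproved input typed as a hypothesis

(61) p. 271 [17], verbatim: *"Complementing the constants in (55) to the full lattice T^{(k)}, and gathering together
all the transformations and estimates, we obtain the inductive inequality (41) for k replaced by k + 1, but with the
additional term* `log Z^{(k)}(B(Λ_{k+1}), U_{k+1}) − log Z^{(k)}(B(Λ_{k+1}), 1).` (61)"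

p. 271, verbatim: *"To complete the proof of the inductive assumption (41) we have to expand the term (61) analogously
to (60). It can be localized in a similar way, although a bit more complicated, as the perturbative expressions. We
write it as the logarithm of the Gaussian integral determined by the quadratic form ⟨A, Δ_kA⟩ and the δ-functions
δ(QA)δ_{Ax}(A). We eliminate the δ-functions and we write the integral in terms of the independent variables Ã
introduced at the beginning of Sect. E [5]. They are connected with A by the simple linear operator C described there,
A = CÃ, and we obtain the Gaussian integral determined by the positive quadratic form ⟨A, C*Δ_kCA⟩* ⟦sic; in the
variables Ã⟧*. The elimination yields also a sum of local terms determined by the coefficient at the variable A(b₀(c))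
in (QA)(c). […] and we obtain the sum of terms −log det S(V_k^{(k)}, b₀(c)). They are simple, local, gauge invariant
functions of V_k^{(k)} = Ū^k_{k+1}, and are analyzed in the same way as the perturbative expressions. We consider the
Gaussian integral now. Its logarithm is equal to a sum of an absolute constant, cancelled by the same constant from
the second term in (61), and the expression* `½ log det(C*Δ_kC)⁻¹ = −½ Tr log(C*Δ_kC) = −(1/4πi)∮_C dz log z
Tr(zI − C*Δ_kC)⁻¹`, *where the contour C is a union of the circle |z| = γ₁* ⟦sic; 2γ₁⟧*, and the two intervals
[2γ₁, 0]* ⟦sic; [−2γ₁, 0]⟧ *with opposite orientations. The number γ₁ is an upper bound of the positive, bounded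
operator C*Δ_kC. Hence the integral above can be written as a sum of two integrals, and we have*
`½ log det(C*Δ_kC)⁻¹ = ½∫₀^{2γ₁} dx Tr(C*Δ_kC + xI)⁻¹ − Σ_{n=0}^∞ (1/4πi)∮_{|z|=2γ₁} dz log z z^{−n−1}(C*Δ_kC)ⁿ
 = ½∫₀^{2γ₁} dx Tr(C*Δ_kC + xI)⁻¹ − ½C*Δ_kC` ⟦sic; `−½ log(2γ₁)·Tr I`⟧ `+ Σ_{n=1}^∞ ((−1)ⁿ/2n)(2γ₁)⁻ⁿ(C*Δ_kC)ⁿ`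
⟦a `Tr` is missing⟧. (63)"

p. 272 [18], verbatim: *"The last sum above can be analyzed now in many ways, for example we may use the formula (3.156)
[5] for the operator Δ_k and expand it into generalized random walks. This gives an expansion for the sum above into
gauge invariant, localized expressions, with proper exponential decay properties. These are analyzed further in the same
way as the perturbative terms. The operator under the integral has a representation similar to (C*Δ_kC)⁻¹. More
exactly the operator C(C*Δ_kC + xI)⁻¹C* is represented by the integral (3.183) [5] with the additional term
−1/2x‖χ̃(QA + D̄μ(QA))‖² under the exponential function, where χ̃ is the characteristic function of the set of bonds
corresponding to variables Ã. This term determines a non-negative, bounded and almost local operator. The integral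
yields the representation analogous to (3.185)* `(C*Δ_kC + xI)⁻¹ = (I + D̄μ)QG̃₃(x)Q*(I + μ*D̄*)↾_{B(Λ_{k+1})}`,
*where G̃₃(x) is defined as G̃₂, but with this additional operator. The operator G̃₃(x) has the same properties as G̃₂,
especially it can be represented by a generalized random walk expansion. By the above formula this gives an expansion
of the last integral in (63) into a sum of gauge invariant, localized terms. They are again analyzed in the way
described before. Now let us notice that gathering together the first terms in the expansions (30) we obtain the
expansion of (63) for the external field U_{k+1} = 1. This is cancelled by the second term in (61), and we obtain the
desired expansion."*

p. 262 [8], verbatim (the walk-term bound and the regrouping by localization): *"A term in the expression, corresponding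
to the walk ω, satisfies the bound (3.108) [5], i.e. can be bounded by* `O(1)O(M₁^{−(1/2)})^{|ω|}M₁^{−(1/2)|ω|}
exp(−½δ₀d(ω, □_i, □_j))` (23), *where d(ω, □_i, □_j) is the length of a shortest tree graph passing through □_i, □_j,
{X_m}. […] The
localizations {□_j} and the walks ω replacing lines of the graph define a localization X of the considered expression.
This localization is simply a union of all these sets. […] Summing the expressions with the same localization X we get
finally the inequality (24) […] With this definition we have* `|𝒫′₁(g₀, X, U₁)| ≦ O(g₀)e^{−κℒ(X)}` (25) *where κ can be
arbitrarily large if M₁ is sufficiently large."* -/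

section leaf

variable {D : LocDomainSys} {Q : Type} [DecidableEq Q] {S : Type} {Φ : Type*}

/-- THE UNPRINTED INPUT of the log Z^{(k)} half, typed as a hypothesis (cell GAPS G-B10-06 / G-IF-10): the terms
`term x b ω` of the generalized random walk expansion of the diagonal resolvent entries at `x` — of
`(C*Δ_k(U)C + xI)⁻¹(b, b)` or of its difference with the `U_{k+1} = 1` entry — obey the bound (23) p. 262 in the
abstract form `|term x b ω| ≤ K·q^{|ω|}·exp(−r·d(dom b ω))` on the space `sp (dom b ω)`, with constants `K, q, r`
INDEPENDENT OF `x ∈ [0, a]` (`a = 2γ₁`).  Printed support: p. 272 *"The operator G̃₃(x) has the same properties as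
G̃₂, especially it can be represented by a generalized random walk expansion"* (by analogy; the x-uniformity is not
stated — it is plausible because the additional term `−1/2x‖χ̃(…)‖²` is non-negative, cell GAPS G-B10-06 (ii)).
Hypothesis only; nothing of the series is asserted. [cite: Balaban1985UV3, p.272 (after (63)); (23) p.262] -/
def G3WalkBound (D : LocDomainSys) (nbrs : Q → Finset Q) (cube : S → Q) (dom : S → List Q → D.Dom)
    (sp : D.Dom → Set Φ) (term : ℝ → S → List Q → Φ → ℂ) (K q r a : ℝ) : Prop :=
  ∀ x ∈ Icc (0 : ℝ) a, ∀ (b : S) (n : ℕ) (ω : List Q) (φ : Φ), ω ∈ B9Thm37Sum.walksFrom nbrs n (cube b) →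
    φ ∈ sp (dom b ω) → ‖term x b ω φ‖ ≤ K * q ^ n * Real.exp (-(r * D.dj (dom b ω)))

end leaf

/-! ## §1. Scalar calculus of (63): one eigenvalue `m > 0` -/

section scalar

variable {m a t γ₁ : ℝ}

/-- `∫₀^a (x + m)⁻¹ dx = log(a + m) − log m` for `m > 0`, `a ≥ 0`. [folklore] -/
theorem integral_inv_add (hm : 0 < m) (ha : 0 ≤ a) :
    ∫ x in (0 : ℝ)..a, (x + m)⁻¹ = Real.log (a + m) - Real.log m := by
  rw [intervalIntegral.integral_comp_add_right (fun y : ℝ => y⁻¹) m, zero_add,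
    integral_inv_of_pos hm (by linarith), Real.log_div (by linarith : a + m ≠ 0) hm.ne']

/-- The series of (63) for one eigenvalue: for `0 ≤ t < 1`,
`Σ_{n≥1} ((−1)ⁿ/(2n)) tⁿ = −½ log(1 + t)` (indexing `n = j + 1`). [folklore] -/
theorem hasSum_series (ht0 : 0 ≤ t) (ht1 : t < 1) :
    HasSum (fun j : ℕ => (-1) ^ (j + 1) / (2 * ((j : ℝ) + 1)) * t ^ (j + 1))
      (-(1 / 2) * Real.log (1 + t)) := by
  have h : |(-t)| < 1 := by rw [abs_neg, abs_of_nonneg ht0]; exact ht1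
  have hs := (Real.hasSum_pow_div_log_of_abs_lt_one h).mul_left (1 / 2)
  rw [sub_neg_eq_add] at hs
  have hfun : (fun j : ℕ => (-1) ^ (j + 1) / (2 * ((j : ℝ) + 1)) * t ^ (j + 1))
      = fun i : ℕ => 1 / 2 * ((-t) ^ (i + 1) / ((i : ℝ) + 1)) := by
    funext j; rw [neg_pow t, div_eq_mul_inv _ (2 * ((j : ℝ) + 1)), mul_inv]; ring
  have hval : -(1 / 2) * Real.log (1 + t) = 1 / 2 * -Real.log (1 + t) := by ring
  rw [hfun, hval]; exact hs

/-- (63) for one eigenvalue `0 < m ≤ γ₁`, kernel-checked, the local integral already evaluated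
(`∫₀^{2γ₁}(x + m)⁻¹dx = log(2γ₁ + m) − log m`):
`Σ_{n≥1}((−1)ⁿ/(2n))(2γ₁)⁻ⁿ mⁿ = −½ log m − ½(log(2γ₁ + m) − log m) + ½ log(2γ₁)`.
[cite: Balaban1985UV3, (63) p.271] -/
theorem hasSum_scalar63 (hm : 0 < m) (hγ : m ≤ γ₁) :
    HasSum (fun j : ℕ => (-1) ^ (j + 1) / (2 * ((j : ℝ) + 1)) * ((2 * γ₁) ^ (j + 1))⁻¹ * m ^ (j + 1))
      (-(1 / 2) * Real.log m - (1 / 2) * (Real.log (2 * γ₁ + m) - Real.log m)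
        + (1 / 2) * Real.log (2 * γ₁)) := by
  have hγpos : 0 < γ₁ := hm.trans_le hγ
  have ha : 0 < 2 * γ₁ := by positivity
  have ht0 : 0 ≤ m / (2 * γ₁) := by positivity
  have ht1 : m / (2 * γ₁) < 1 := by rw [div_lt_one ha]; linarith
  have hs := hasSum_series ht0 ht1
  have hskel := B10.logdet63_skeleton m (2 * γ₁) hm ha
  rw [show 2 * γ₁ + m = m + 2 * γ₁ by ring]
  convert hs using 1
  · funext j; rw [div_pow]; ring
  · rw [hskel]; ring

/-- (63) for one eigenvalue `0 < m ≤ γ₁` with the local integral displayed: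
`−½ log m = ½∫₀^{2γ₁}(x + m)⁻¹dx − ½ log(2γ₁) + Σ_{n≥1}((−1)ⁿ/(2n))(2γ₁)⁻ⁿ mⁿ`.
[cite: Balaban1985UV3, (63) p.271] -/
theorem scalar63 (hm : 0 < m) (hγ : m ≤ γ₁) :
    -(1 / 2) * Real.log m = (1 / 2) * (∫ x in (0 : ℝ)..(2 * γ₁), (x + m)⁻¹) - (1 / 2) * Real.log (2 * γ₁)
      + ∑' j : ℕ, (-1) ^ (j + 1) / (2 * ((j : ℝ) + 1)) * ((2 * γ₁) ^ (j + 1))⁻¹ * m ^ (j + 1) := by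
  have hγpos : 0 < γ₁ := hm.trans_le hγ
  rw [(hasSum_scalar63 hm hγ).tsum_eq, integral_inv_add hm (by positivity : (0:ℝ) ≤ 2 * γ₁)]
  ring

/-- `∫₀^∞ ((x + a)⁻¹ − (x + b)⁻¹) dx = log b − log a` for `a, b > 0`: the resolvent-integral formula for a
difference of logarithms on the whole half-line. [folklore] -/
theorem integral_Ioi_inv_sub_inv {a b : ℝ} (ha : 0 < a) (hb : 0 < b) :
    IntegrableOn (fun x : ℝ => (x + a)⁻¹ - (x + b)⁻¹) (Ioi 0) ∧
    ∫ x in Ioi (0 : ℝ), ((x + a)⁻¹ - (x + b)⁻¹) = Real.log b - Real.log a := by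
  -- antiderivative F x = log (x + a) - log (x + b), F → 0 at ∞, F 0 = log a - log b
  set F : ℝ → ℝ := fun x => Real.log (x + a) - Real.log (x + b) with hF
  have hderiv : ∀ x ∈ Ici (0 : ℝ), HasDerivAt F ((x + a)⁻¹ - (x + b)⁻¹) x := by
    intro x hx
    have hxa : x + a ≠ 0 := by have := mem_Ici.1 hx; positivity
    have hxb : x + b ≠ 0 := by have := mem_Ici.1 hx; positivity
    have h1 : HasDerivAt (fun x => Real.log (x + a)) ((x + a)⁻¹) x := by
      simpa using ((hasDerivAt_id x).add_const a).log hxa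
    have h2 : HasDerivAt (fun x => Real.log (x + b)) ((x + b)⁻¹) x := by
      simpa using ((hasDerivAt_id x).add_const b).log hxb
    exact h1.sub h2
  have hlim : Tendsto F atTop (𝓝 0) := by
    have h1 : Tendsto (fun x : ℝ => (x + a) / (x + b)) atTop (𝓝 1) := by
      have e : (fun x : ℝ => (x + a) / (x + b)) =ᶠ[atTop] fun x => 1 + (a - b) * (x + b)⁻¹ := by
        filter_upwards [eventually_gt_atTop 0] with x hx
        have hxb : x + b ≠ 0 := by positivity
        field_simp; ring
      rw [tendsto_congr' e]
      have h2 : Tendsto (fun x : ℝ => (x + b)⁻¹) atTop (𝓝 0) :=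
        tendsto_inv_atTop_zero.comp (tendsto_atTop_add_const_right atTop b tendsto_id)
      simpa using (h2.const_mul (a - b)).const_add 1
    have h3 : Tendsto (fun x : ℝ => Real.log ((x + a) / (x + b))) atTop (𝓝 0) := by
      have := (Real.continuousAt_log one_ne_zero).tendsto.comp h1
      rw [Real.log_one] at this
      exact this
    refine h3.congr' ?_
    filter_upwards [eventually_gt_atTop 0] with x hx
    have hxa : 0 < x + a := by positivity
    have hxb : 0 < x + b := by positivity
    rw [hF]; dsimp only; rw [Real.log_div hxa.ne' hxb.ne']
  have hF0 : F 0 = Real.log a - Real.log b := by simp [hF]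
  -- integrability: the derivative has constant sign
  have hint : IntegrableOn (fun x : ℝ => (x + a)⁻¹ - (x + b)⁻¹) (Ioi 0) := by
    rcases le_total a b with hab | hab
    · refine integrableOn_Ioi_deriv_of_nonneg' hderiv (fun x hx => ?_) hlim
      have hx0 : 0 < x := hx
      have hxa : 0 < x + a := by positivity
      rw [sub_nonneg]; exact inv_anti₀ hxa (by linarith)
    · have hderiv' : ∀ x ∈ Ici (0 : ℝ), HasDerivAt (fun x => -F x) (-((x + a)⁻¹ - (x + b)⁻¹)) x :=
        fun x hx => (hderiv x hx).neg
      have hlim' : Tendsto (fun x => -F x) atTop (𝓝 (-0)) := hlim.neg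
      have h := integrableOn_Ioi_deriv_of_nonneg' hderiv' (fun x hx => ?_) hlim'
      · convert h.neg using 1; funext x; simp only [Pi.neg_apply]; ring
      have hx0 : 0 < x := hx
      have hxb : 0 < x + b := by positivity
      rw [neg_sub, sub_nonneg]; exact inv_anti₀ hxb (by linarith)
  refine ⟨hint, ?_⟩
  rw [integral_Ioi_of_hasDerivAt_of_tendsto' hderiv hint hlim, hF0]; ring

end scalar

/-! ## §2. Matrix level -/

section matrix

variable {n : Type*} [Fintype n] [DecidableEq n] {T T₀ T₁ : Matrix n n ℝ}

/-- `log det T = Σ_k log λ_k` for `T ≻ 0`. [folklore] -/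
theorem log_det_eq_sum (hT : T.PosDef) : Real.log T.det = ∑ k, Real.log (hT.1.eigenvalues k) := by
  rw [hT.1.det_eq_prod_eigenvalues]
  simp only [RCLike.ofReal_real_eq_id, id_eq]
  exact Real.log_prod (fun k _ => (hT.eigenvalues_pos k).ne')

/-- `Tr (xI + T)⁻¹ = Σ_k (x + λ_k)⁻¹` for `T ≻ 0`, `x ≥ 0`. [folklore] -/
theorem trace_resolvent_eq_sum (hT : T.PosDef) {x : ℝ} (hx : 0 ≤ x) :
    trace ((x • (1 : Matrix n n ℝ) + T)⁻¹) = ∑ k, (x + hT.1.eigenvalues k)⁻¹ := by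
  rw [B13Sqrt27.resolvent_eq_cfc hT hx,
    Literature.LinearAlgebra.Matrix.trace_cfc_eq_sum_eigenvalues hT.1]
  simp

/-- `Tr T^m = Σ_k λ_k^m` for symmetric `T`. [folklore] -/
theorem trace_pow_eq_sum (hT : T.IsHermitian) (m : ℕ) : trace (T ^ m) = ∑ k, hT.eigenvalues k ^ m := by
  have hT' : IsSelfAdjoint T := hT
  rw [← cfc_pow_id (R := ℝ) T m, Literature.LinearAlgebra.Matrix.trace_cfc_eq_sum_eigenvalues hT]
  simp

/-- The trace of the resolvent is interval-integrable on `[0, a]` and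
`∫₀^a Tr (xI + T)⁻¹ dx = Σ_k (log(a + λ_k) − log λ_k)`. [folklore] -/
theorem integral_trace_resolvent (hT : T.PosDef) {a : ℝ} (ha : 0 ≤ a) :
    ∫ x in (0 : ℝ)..a, trace ((x • (1 : Matrix n n ℝ) + T)⁻¹)
      = ∑ k, (Real.log (a + hT.1.eigenvalues k) - Real.log (hT.1.eigenvalues k)) := by
  have hev : ∀ k, 0 < hT.1.eigenvalues k := hT.eigenvalues_pos
  rw [intervalIntegral.integral_congr (g := fun x => ∑ k, (x + hT.1.eigenvalues k)⁻¹) (fun x hx => ?_)]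
  · rw [intervalIntegral.integral_finsetSum (fun k _ => ?_)]
    · exact Finset.sum_congr rfl fun k _ => integral_inv_add (hev k) ha
    · refine intervalIntegral.intervalIntegrable_inv (fun x hx => ?_) (by fun_prop)
      rw [uIcc_of_le ha] at hx
      exact (add_pos_of_nonneg_of_pos hx.1 (hev k)).ne'
  · rw [uIcc_of_le ha] at hx
    exact trace_resolvent_eq_sum hT hx.1

/-- The trace of the resolvent is continuous on `[0, a]`, hence interval-integrable there. [folklore] -/
theorem intervalIntegrable_trace_resolvent (hT : T.PosDef) {a : ℝ} (ha : 0 ≤ a) :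
    IntervalIntegrable (fun x : ℝ => trace ((x • (1 : Matrix n n ℝ) + T)⁻¹)) volume 0 a := by
  have hev : ∀ k, 0 < hT.1.eigenvalues k := hT.eigenvalues_pos
  refine ContinuousOn.intervalIntegrable ?_
  rw [uIcc_of_le ha]
  have hg : ContinuousOn (fun x : ℝ => ∑ k, (x + hT.1.eigenvalues k)⁻¹) (Icc 0 a) := by
    refine continuousOn_finsetSum _ fun k _ => ContinuousOn.inv₀ (by fun_prop) fun x hx => ?_
    exact (add_pos_of_nonneg_of_pos hx.1 (hev k)).ne'
  exact hg.congr fun x hx => trace_resolvent_eq_sum hT hx.1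

/-- **(63) at operator level, for a positive definite real symmetric matrix `T` with every eigenvalue `≤ γ₁`**
(*"The number γ₁ is an upper bound of the positive, bounded operator C*Δ_kC"*), the series as a `HasSum`:
`Σ_{n≥1}((−1)ⁿ/(2n))(2γ₁)⁻ⁿ Tr Tⁿ = −½ log det T − ½∫₀^{2γ₁}dx Tr(T + xI)⁻¹ + ½ log(2γ₁)·Tr I`.
[cite: Balaban1985UV3, (63) p.271] -/
theorem hasSum_matrix63 (hT : T.PosDef) {γ₁ : ℝ} (hγ₁ : 0 < γ₁) (hγ : ∀ k, hT.1.eigenvalues k ≤ γ₁) :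
    HasSum (fun j : ℕ => (-1) ^ (j + 1) / (2 * ((j : ℝ) + 1)) * ((2 * γ₁) ^ (j + 1))⁻¹ * trace (T ^ (j + 1)))
      (-(1 / 2) * Real.log T.det - (1 / 2) * (∫ x in (0 : ℝ)..(2 * γ₁), trace ((x • (1 : Matrix n n ℝ) + T)⁻¹))
        + (1 / 2) * (Fintype.card n : ℝ) * Real.log (2 * γ₁)) := by
  have hev : ∀ k, 0 < hT.1.eigenvalues k := hT.eigenvalues_pos
  have hterm : (fun j : ℕ => (-1) ^ (j + 1) / (2 * ((j : ℝ) + 1)) * ((2 * γ₁) ^ (j + 1))⁻¹ * trace (T ^ (j + 1)))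
      = fun j : ℕ => ∑ k, (-1) ^ (j + 1) / (2 * ((j : ℝ) + 1)) * ((2 * γ₁) ^ (j + 1))⁻¹
          * hT.1.eigenvalues k ^ (j + 1) := by
    funext j; rw [trace_pow_eq_sum hT.1, Finset.mul_sum]
  have hval : -(1 / 2) * Real.log T.det
        - (1 / 2) * (∫ x in (0 : ℝ)..(2 * γ₁), trace ((x • (1 : Matrix n n ℝ) + T)⁻¹))
        + (1 / 2) * (Fintype.card n : ℝ) * Real.log (2 * γ₁)
      = ∑ k, (-(1 / 2) * Real.log (hT.1.eigenvalues k)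
          - (1 / 2) * (Real.log (2 * γ₁ + hT.1.eigenvalues k) - Real.log (hT.1.eigenvalues k))
          + (1 / 2) * Real.log (2 * γ₁)) := by
    rw [log_det_eq_sum hT, integral_trace_resolvent hT (by positivity : (0 : ℝ) ≤ 2 * γ₁)]
    simp only [Finset.sum_add_distrib, Finset.sum_sub_distrib, ← Finset.mul_sum, Finset.sum_const,
      Finset.card_univ, nsmul_eq_mul]
    ring
  rw [hterm, hval]
  exact hasSum_sum fun k _ => hasSum_scalar63 (hev k) (hγ k)

/-- **(63) at operator level** (corrected reading of the printed display, cell DIVERGENCE D-adv2-1 / GAPS G-adv2-9: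
the constant term is `−½ log(2γ₁)·Tr I` ⟦printed "−½C*Δ_kC"⟧ and the last sum carries a trace):
`−½ log det T = ½∫₀^{2γ₁}dx Tr(T + xI)⁻¹ − ½ log(2γ₁)·Tr I + Σ_{n≥1}((−1)ⁿ/(2n))(2γ₁)⁻ⁿ Tr Tⁿ`
for `T ≻ 0` real symmetric with every eigenvalue `≤ γ₁`. [cite: Balaban1985UV3, (63) p.271] -/
theorem matrix63 (hT : T.PosDef) {γ₁ : ℝ} (hγ₁ : 0 < γ₁) (hγ : ∀ k, hT.1.eigenvalues k ≤ γ₁) :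
    -(1 / 2) * Real.log T.det
      = (1 / 2) * (∫ x in (0 : ℝ)..(2 * γ₁), trace ((x • (1 : Matrix n n ℝ) + T)⁻¹))
        - (1 / 2) * (Fintype.card n : ℝ) * Real.log (2 * γ₁)
        + ∑' j : ℕ, (-1) ^ (j + 1) / (2 * ((j : ℝ) + 1)) * ((2 * γ₁) ^ (j + 1))⁻¹ * trace (T ^ (j + 1)) := by
  rw [(hasSum_matrix63 hT hγ₁ hγ).tsum_eq]; ring

/-- **(63) under a form bound** (*"γ₁ is an upper bound of the positive, bounded operator"* read as
`⟨v, Tv⟩ ≤ γ₁‖v‖²`; the cell's interface C-IF-07 (E2) supplies such a `γ₁` for `T = C*Δ_kC`).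
[cite: Balaban1985UV3, (63) p.271] -/
theorem matrix63_of_form_le (hT : T.PosDef) {γ₁ : ℝ} (hγ₁ : 0 < γ₁)
    (hγ : ∀ v : n → ℝ, v ⬝ᵥ (T *ᵥ v) ≤ γ₁ * (v ⬝ᵥ v)) :
    -(1 / 2) * Real.log T.det
      = (1 / 2) * (∫ x in (0 : ℝ)..(2 * γ₁), trace ((x • (1 : Matrix n n ℝ) + T)⁻¹))
        - (1 / 2) * (Fintype.card n : ℝ) * Real.log (2 * γ₁)
        + ∑' j : ℕ, (-1) ^ (j + 1) / (2 * ((j : ℝ) + 1)) * ((2 * γ₁) ^ (j + 1))⁻¹ * trace (T ^ (j + 1)) :=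
  matrix63 hT hγ₁ (B13Sqrt27.eigenvalues_le_of_form_le hT.1 hγ)

/-- **(61) expanded by (63) for both fields** (*"gathering together the first terms in the expansions (30) we obtain
the expansion of (63) for the external field U_{k+1} = 1. This is cancelled by the second term in (61)"*): for two
positive definite `T₁` (field `U_{k+1}`) and `T₀` (field `1`) with the common upper bound `γ₁`, the constant
`−½ log(2γ₁)·Tr I` cancels and
`(−½ log det T₁) − (−½ log det T₀) = ½∫₀^{2γ₁}dx [Tr(T₁ + x)⁻¹ − Tr(T₀ + x)⁻¹] + Σ_{n≥1}((−1)ⁿ/(2n))(2γ₁)⁻ⁿ[Tr T₁ⁿ − Tr T₀ⁿ]`.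
[cite: Balaban1985UV3, (61)/(63) pp.271–272] -/
theorem diff61_split (hT₀ : T₀.PosDef) (hT₁ : T₁.PosDef) {γ₁ : ℝ} (hγ₁ : 0 < γ₁)
    (h₀ : ∀ k, hT₀.1.eigenvalues k ≤ γ₁) (h₁ : ∀ k, hT₁.1.eigenvalues k ≤ γ₁) :
    -(1 / 2) * Real.log T₁.det - (-(1 / 2) * Real.log T₀.det)
      = (1 / 2) * (∫ x in (0 : ℝ)..(2 * γ₁),
            (trace ((x • (1 : Matrix n n ℝ) + T₁)⁻¹) - trace ((x • (1 : Matrix n n ℝ) + T₀)⁻¹)))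
        + ∑' j : ℕ, (-1) ^ (j + 1) / (2 * ((j : ℝ) + 1)) * ((2 * γ₁) ^ (j + 1))⁻¹
            * (trace (T₁ ^ (j + 1)) - trace (T₀ ^ (j + 1))) := by
  have hs := (hasSum_matrix63 hT₁ hγ₁ h₁).sub (hasSum_matrix63 hT₀ hγ₁ h₀)
  have hs' : HasSum (fun j : ℕ => (-1) ^ (j + 1) / (2 * ((j : ℝ) + 1)) * ((2 * γ₁) ^ (j + 1))⁻¹
      * (trace (T₁ ^ (j + 1)) - trace (T₀ ^ (j + 1))))
      ((-(1 / 2) * Real.log T₁.det - (1 / 2) * (∫ x in (0 : ℝ)..(2 * γ₁), trace ((x • (1 : Matrix n n ℝ) + T₁)⁻¹))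
        + (1 / 2) * (Fintype.card n : ℝ) * Real.log (2 * γ₁))
      - (-(1 / 2) * Real.log T₀.det - (1 / 2) * (∫ x in (0 : ℝ)..(2 * γ₁), trace ((x • (1 : Matrix n n ℝ) + T₀)⁻¹))
        + (1 / 2) * (Fintype.card n : ℝ) * Real.log (2 * γ₁))) := by
    convert hs using 1
    all_goals first | rfl | (funext j; ring)
  rw [hs'.tsum_eq, intervalIntegral.integral_sub (intervalIntegrable_trace_resolvent hT₁ (by positivity))
    (intervalIntegrable_trace_resolvent hT₀ (by positivity))]
  ring

/-- **The log-determinant difference as a resolvent integral over the whole half-line** (the form in which the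
x-uniformity question of cell GAPS G-B10-06 (ii) / G-IF-10 is posed: `(C*Δ_kC + x)⁻¹, x ≥ 0`):
`log det T₁ − log det T₀ = ∫₀^∞ [Tr(T₀ + x)⁻¹ − Tr(T₁ + x)⁻¹] dx`, the integrand being integrable. [folklore] -/
theorem diff61_Ioi (hT₀ : T₀.PosDef) (hT₁ : T₁.PosDef) :
    IntegrableOn (fun x : ℝ => trace ((x • (1 : Matrix n n ℝ) + T₀)⁻¹) - trace ((x • (1 : Matrix n n ℝ) + T₁)⁻¹))
        (Ioi 0) ∧
      ∫ x in Ioi (0 : ℝ), (trace ((x • (1 : Matrix n n ℝ) + T₀)⁻¹) - trace ((x • (1 : Matrix n n ℝ) + T₁)⁻¹))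
        = Real.log T₁.det - Real.log T₀.det := by
  have hev₀ : ∀ k, 0 < hT₀.1.eigenvalues k := hT₀.eigenvalues_pos
  have hev₁ : ∀ k, 0 < hT₁.1.eigenvalues k := hT₁.eigenvalues_pos
  have heq : EqOn (fun x : ℝ => trace ((x • (1 : Matrix n n ℝ) + T₀)⁻¹) - trace ((x • (1 : Matrix n n ℝ) + T₁)⁻¹))
      (fun x => ∑ k, ((x + hT₀.1.eigenvalues k)⁻¹ - (x + hT₁.1.eigenvalues k)⁻¹)) (Ioi 0) := by
    intro x hx
    have hx' : 0 ≤ x := le_of_lt hx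
    simp only [trace_resolvent_eq_sum hT₀ hx', trace_resolvent_eq_sum hT₁ hx', Finset.sum_sub_distrib]
  have hint : IntegrableOn (fun x : ℝ => ∑ k, ((x + hT₀.1.eigenvalues k)⁻¹ - (x + hT₁.1.eigenvalues k)⁻¹))
      (Ioi 0) :=
    integrable_finsetSum _ fun k _ => (integral_Ioi_inv_sub_inv (hev₀ k) (hev₁ k)).1
  refine ⟨hint.congr_fun heq.symm measurableSet_Ioi, ?_⟩
  rw [setIntegral_congr_fun measurableSet_Ioi heq,
    integral_finsetSum _ (fun k _ => (integral_Ioi_inv_sub_inv (hev₀ k) (hev₁ k)).1),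
    log_det_eq_sum hT₀, log_det_eq_sum hT₁, ← Finset.sum_sub_distrib]
  exact Finset.sum_congr rfl fun k _ => (integral_Ioi_inv_sub_inv (hev₀ k) (hev₁ k)).2

end matrix


/-! ## §2b. The Gaussian normalisation sentence of p. 271 -/

section gaussian

variable {ι : Type*} [Fintype ι] [DecidableEq ι]

/-- p. 271, *"Its logarithm is equal to a sum of an absolute constant, cancelled by the same constant from the second
term in (61), and the expression ½ log det(C*Δ_kC)⁻¹"*, kernel-checked for the unconstrained Gaussian integrals in the
variables Ã (after the elimination `A = CÃ`, which is NOT modelled): for positive definite `T₁` (field `U_{k+1}`) and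
`T₀` (field `1`) the constants `(|ι|/2) log 2π` cancel in the difference (61) and
`log ∫ e^{−½⟨v,T₁v⟩}dv − log ∫ e^{−½⟨v,T₀v⟩}dv = ½ log det T₁⁻¹ − ½ log det T₀⁻¹`.  From the tree's
`Beta.GaussianIntegral.log_integral_exp_neg_half_quadForm`. [cite: Balaban1985UV3, p.271 (before (63))] -/
theorem log_gaussian_diff61 (T₀ T₁ : Matrix ι ι ℝ) (hT₀ : T₀.PosDef) (hT₁ : T₁.PosDef) :
    Real.log (∫ v : ι → ℝ, Real.exp (-(1/2 : ℝ) * (v ⬝ᵥ T₁ *ᵥ v)))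
        - Real.log (∫ v : ι → ℝ, Real.exp (-(1/2 : ℝ) * (v ⬝ᵥ T₀ *ᵥ v)))
      = -(1 / 2) * Real.log T₁.det - (-(1 / 2) * Real.log T₀.det) := by
  rw [Beta.GaussianIntegral.log_integral_exp_neg_half_quadForm T₁ hT₁,
    Beta.GaussianIntegral.log_integral_exp_neg_half_quadForm T₀ hT₀]
  ring

end gaussian

/-! ## §3. "Summing the expressions with the same localization X": walk terms regrouped by localization domain -/

section walks

variable {D : LocDomainSys} [DecidableEq D.Dom] {Q : Type} [DecidableEq Q] {S : Type} [Fintype S] {Φ : Type*}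

/-- The level-`n` part of the localized term attached to `X`: the sum of the walk terms `term b ω` over the starting
sites `b` and the `n`-step walks `ω` from the cube of `b` whose localization domain `dom b ω` is `X`.
[cite: Balaban1985UV3, p.262 (before (24))] -/
def level (nbrs : Q → Finset Q) (cube : S → Q) (dom : S → List Q → D.Dom) (term : S → List Q → Φ → ℂ)
    (X : D.Dom) (n : ℕ) (φ : Φ) : ℂ :=
  ∑ b : S, ∑ ω ∈ (B9Thm37Sum.walksFrom nbrs n (cube b)).filter (fun ω => dom b ω = X), term b ω φ

/-- The localized term attached to `X`: all levels summed ("Summing the expressions with the same localization X",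
p. 262). [cite: Balaban1985UV3, p.262 (before (24))] -/
def Elog (nbrs : Q → Finset Q) (cube : S → Q) (dom : S → List Q → D.Dom) (term : S → List Q → Φ → ℂ)
    (X : D.Dom) (φ : Φ) : ℂ :=
  ∑' n : ℕ, level nbrs cube dom term X n φ

variable {nbrs : Q → Finset Q} {cube : S → Q} {dom : S → List Q → D.Dom} {term : S → List Q → Φ → ℂ}
  {cubes : D.Dom → Finset Q} {sp : D.Dom → Set Φ} {Dg V : ℕ} {K q r : ℝ}

omit [DecidableEq D.Dom] in
/-- Counting the starting sites: if every cube carries at most `V` sites, at most `V·#cubes(X)` sites lie in the cubes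
of `X`. [folklore] -/
theorem card_sites_le (hV : ∀ c : Q, (univ.filter fun b : S => cube b = c).card ≤ V) (X : D.Dom) :
    ((univ.filter fun b : S => cube b ∈ cubes X).card : ℝ) ≤ V * (cubes X).card := by
  have h := sum_card_fiberwise_eq_card_filter (univ : Finset S) (cubes X) cube
  have h2 : ∑ j ∈ cubes X, (univ.filter fun b : S => cube b = j).card ≤ ∑ _j ∈ cubes X, V :=
    sum_le_sum fun j _ => hV j
  rw [sum_const, smul_eq_mul, h] at h2
  calc ((univ.filter fun b : S => cube b ∈ cubes X).card : ℝ) ≤ ((cubes X).card * V : ℕ) := by exact_mod_cast h2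
    _ = V * (cubes X).card := by push_cast; ring

/-- **The level bound.**  Hypotheses: every cube meets at most `Dg` cubes (`hD`), carries at most `V` sites (`hV`);
a walk starts inside its localization domain (`hstart`); and the printed per-term bound (23) p. 262 in the abstract
form `|term b ω| ≤ K q^{|ω|} exp(−r d(dom b ω))` on the space `sp (dom b ω)` (`hterm`).  Then the level-`n` part of the
term localized in `X` is at most `K·V·#cubes(X)·(Dg·q)ⁿ·exp(−r d(X))` on `sp X`. [cite: Balaban1985UV3, (23)–(24) p.262] -/
theorem norm_level_le (hD : ∀ c, (nbrs c).card ≤ Dg) (hV : ∀ c : Q, (univ.filter fun b : S => cube b = c).card ≤ V)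
    (hstart : ∀ b n ω, ω ∈ B9Thm37Sum.walksFrom nbrs n (cube b) → cube b ∈ cubes (dom b ω))
    (hK : 0 ≤ K) (hq : 0 ≤ q)
    (hterm : ∀ b n ω φ, ω ∈ B9Thm37Sum.walksFrom nbrs n (cube b) → φ ∈ sp (dom b ω) →
      ‖term b ω φ‖ ≤ K * q ^ n * Real.exp (-(r * D.dj (dom b ω))))
    (X : D.Dom) (n : ℕ) {φ : Φ} (hφ : φ ∈ sp X) :
    ‖level nbrs cube dom term X n φ‖
      ≤ K * V * (cubes X).card * (Dg * q) ^ n * Real.exp (-(r * D.dj X)) := by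
  classical
  unfold level
  set w : ℝ := K * q ^ n * Real.exp (-(r * D.dj X)) with hw
  have hw0 : 0 ≤ w := by positivity
  -- each inner sum: at most (#walks with dom = X) * w, and zero unless cube b ∈ cubes X
  have hinner : ∀ b : S, ‖∑ ω ∈ (B9Thm37Sum.walksFrom nbrs n (cube b)).filter (fun ω => dom b ω = X), term b ω φ‖
      ≤ (if cube b ∈ cubes X then (Dg : ℝ) ^ n * w else 0) := by
    intro b
    split_ifs with hb
    · calc ‖∑ ω ∈ (B9Thm37Sum.walksFrom nbrs n (cube b)).filter (fun ω => dom b ω = X), term b ω φ‖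
            ≤ ∑ ω ∈ (B9Thm37Sum.walksFrom nbrs n (cube b)).filter (fun ω => dom b ω = X), ‖term b ω φ‖ := norm_sum_le _ _
          _ ≤ ∑ _ω ∈ (B9Thm37Sum.walksFrom nbrs n (cube b)).filter (fun ω => dom b ω = X), w := by
              refine sum_le_sum fun ω hω => ?_
              rw [mem_filter] at hω
              have := hterm b n ω φ hω.1 (hω.2 ▸ hφ)
              rwa [hω.2] at this
          _ = ((B9Thm37Sum.walksFrom nbrs n (cube b)).filter (fun ω => dom b ω = X)).card * w := by
              rw [sum_const, nsmul_eq_mul]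
          _ ≤ (Dg : ℝ) ^ n * w := by
              refine mul_le_mul_of_nonneg_right ?_ hw0
              exact_mod_cast (card_filter_le _ _).trans (B9Thm37Sum.card_walksFrom_le nbrs hD n (cube b))
    · have hempty : (B9Thm37Sum.walksFrom nbrs n (cube b)).filter (fun ω => dom b ω = X) = ∅ := by
        refine filter_eq_empty_iff.2 fun ω hω hdom => hb ?_
        rw [← hdom]; exact hstart b n ω hω
      rw [hempty, sum_empty, norm_zero]
  calc ‖∑ b : S, ∑ ω ∈ (B9Thm37Sum.walksFrom nbrs n (cube b)).filter (fun ω => dom b ω = X), term b ω φ‖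
        ≤ ∑ b : S, ‖∑ ω ∈ (B9Thm37Sum.walksFrom nbrs n (cube b)).filter (fun ω => dom b ω = X), term b ω φ‖ := norm_sum_le _ _
    _ ≤ ∑ b : S, (if cube b ∈ cubes X then (Dg : ℝ) ^ n * w else 0) := sum_le_sum fun b _ => hinner b
    _ = (univ.filter fun b : S => cube b ∈ cubes X).card * ((Dg : ℝ) ^ n * w) := by
        rw [← sum_filter, sum_const, nsmul_eq_mul]
    _ ≤ (V * (cubes X).card : ℝ) * ((Dg : ℝ) ^ n * w) :=
        mul_le_mul_of_nonneg_right (card_sites_le hV X) (by positivity)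
    _ = K * V * (cubes X).card * (Dg * q) ^ n * Real.exp (-(r * D.dj X)) := by rw [hw, mul_pow]; ring

/-- Summability of the levels when `Dg·q < 1` (the walk entropy is beaten by the per-step factor: *"We will use the
factor O(M^{−1/2}) to control the sum over random walks ω"*, [5] p. 410). [folklore] -/
theorem summable_level (hD : ∀ c, (nbrs c).card ≤ Dg) (hV : ∀ c : Q, (univ.filter fun b : S => cube b = c).card ≤ V)
    (hstart : ∀ b n ω, ω ∈ B9Thm37Sum.walksFrom nbrs n (cube b) → cube b ∈ cubes (dom b ω))
    (hK : 0 ≤ K) (hq : 0 ≤ q) (hDq : Dg * q < 1)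
    (hterm : ∀ b n ω φ, ω ∈ B9Thm37Sum.walksFrom nbrs n (cube b) → φ ∈ sp (dom b ω) →
      ‖term b ω φ‖ ≤ K * q ^ n * Real.exp (-(r * D.dj (dom b ω))))
    (X : D.Dom) {φ : Φ} (hφ : φ ∈ sp X) : Summable fun n => level nbrs cube dom term X n φ := by
  have hDq0 : 0 ≤ (Dg : ℝ) * q := by positivity
  refine Summable.of_norm_bounded (g := fun n => K * V * (cubes X).card * Real.exp (-(r * D.dj X)) * (Dg * q) ^ n)
    ((summable_geometric_of_lt_one hDq0 hDq).mul_left _) fun n => ?_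
  calc ‖level nbrs cube dom term X n φ‖ ≤ _ := norm_level_le hD hV hstart hK hq hterm X n hφ
    _ = _ := by ring

/-- **"Summing the expressions with the same localization X we get finally the inequality (24) … (25)"** (p. 262), the
bookkeeping kernel-checked in the abstract: under the hypotheses of `norm_level_le` and `Dg·q < 1`, the localized
terms `Elog X = Σ_n level X n` obey the per-cube shape of `B13.LogHalfBound` with the SAME rate `r` and the per-cube
constant `B = K·V/(1 − Dg·q)` — `V` = sites per cube, `K` = the per-term constant of (23).  This is the sentence of cell
GAPS G-B13-12 *"the shape a random-walk expansion of [13]/[16]-type delivers term by term (each site of X carries one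
resolvent term)"* as a theorem; which READING of the constant results ((a) absolute / (b) O((LM)^d), G-B13-12a) is
decided by what `K` carries, see `logHalfBound_perSite`. [cite: Balaban1985UV3, (23)–(25) p.262] -/
theorem logHalfBound_of_walks (hD : ∀ c, (nbrs c).card ≤ Dg)
    (hV : ∀ c : Q, (univ.filter fun b : S => cube b = c).card ≤ V)
    (hstart : ∀ b n ω, ω ∈ B9Thm37Sum.walksFrom nbrs n (cube b) → cube b ∈ cubes (dom b ω))
    (hK : 0 ≤ K) (hq : 0 ≤ q) (hDq : Dg * q < 1)
    (hterm : ∀ b n ω φ, ω ∈ B9Thm37Sum.walksFrom nbrs n (cube b) → φ ∈ sp (dom b ω) →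
      ‖term b ω φ‖ ≤ K * q ^ n * Real.exp (-(r * D.dj (dom b ω)))) :
    B13.LogHalfBound D sp (Elog nbrs cube dom term) (fun X => (cubes X).card) (K * V / (1 - Dg * q)) r := by
  intro X φ hφ
  have hDq0 : 0 ≤ (Dg : ℝ) * q := by positivity
  have hgeo := (hasSum_geometric_of_lt_one hDq0 hDq).mul_left (K * V * (cubes X).card * Real.exp (-(r * D.dj X)))
  unfold Elog
  refine (tsum_of_norm_bounded hgeo fun n => ?_).trans (le_of_eq ?_)
  · calc ‖level nbrs cube dom term X n φ‖ ≤ _ := norm_level_le hD hV hstart hK hq hterm X n hφ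
      _ = _ := by ring
  · rw [div_eq_mul_inv]; ring

/-- The DICHOTOMY of cell GAPS G-B13-12a made structural: if the per-term constant factors as `K = K₀·θ` (θ = the
smallness carried by the obligatory background-dependent vertex of every term of the DIFFERENCE (61) — each term of
`log Z^{(k)}(U_{k+1}) − log Z^{(k)}(1)` contains at least one factor vanishing at `U_{k+1} = 1`, p. 272: *"we obtain
the expansion of (63) for the external field U_{k+1} = 1. This is cancelled by the second term in (61)"*), the
per-cube constant is `(K₀/(1 − Dg·q))·θ·V`: reading (a) of G-B13-12a (`B = A·θ·(LM)^d`, absolute after R21 iff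
`θ·(LM)^d = O(1)`) when θ is a per-site smallness, reading (b) (`B = A·(LM)^d`) when it is not.  Which θ the walk
expansion of G̃₃(x) actually delivers is NOT decided here (G-IF-10). [cite: Balaban1985UV3, p.272 (after (63))] -/
theorem logHalfBound_perSite (hD : ∀ c, (nbrs c).card ≤ Dg)
    (hV : ∀ c : Q, (univ.filter fun b : S => cube b = c).card ≤ V)
    (hstart : ∀ b n ω, ω ∈ B9Thm37Sum.walksFrom nbrs n (cube b) → cube b ∈ cubes (dom b ω))
    {K₀ θ : ℝ} (hK₀ : 0 ≤ K₀) (hθ : 0 ≤ θ) (hq : 0 ≤ q) (hDq : Dg * q < 1)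
    (hterm : ∀ b n ω φ, ω ∈ B9Thm37Sum.walksFrom nbrs n (cube b) → φ ∈ sp (dom b ω) →
      ‖term b ω φ‖ ≤ K₀ * θ * q ^ n * Real.exp (-(r * D.dj (dom b ω)))) :
    B13.LogHalfBound D sp (Elog nbrs cube dom term) (fun X => (cubes X).card) (K₀ / (1 - Dg * q) * θ * V) r := by
  have h := logHalfBound_of_walks (K := K₀ * θ) hD hV hstart (mul_nonneg hK₀ hθ) hq hDq hterm
  have heq : K₀ * θ * V / (1 - Dg * q) = K₀ / (1 - Dg * q) * θ * V := by ring
  rwa [heq] at h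

/-- **Per-step decay instead of per-term decay.**  When only the LINEAR GROWTH of the tree length along a walk is
known — `d(dom b ω) ≤ ℓ₀·|ω| + ℓ₁` (`hlen`: consecutive cubes are adjacent, every step adds at most ℓ₀ to the tree
length) — and the terms obey `|term b ω| ≤ K q^{|ω|}` with a per-step factor so small that `Dg·q·e^{rℓ₀} < 1`, the same
shape follows with rate `r` and constant `K·e^{rℓ₁}·V/(1 − Dg·q·e^{rℓ₀})` (p. 262 (25): *"where κ can be arbitrarily
large if M₁ is sufficiently large"*).  Reduction to `logHalfBound_of_walks` with `q ↦ q·e^{rℓ₀}`.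
[cite: Balaban1985UV3, (25) p.262] -/
theorem logHalfBound_of_walks_linear (hD : ∀ c, (nbrs c).card ≤ Dg)
    (hV : ∀ c : Q, (univ.filter fun b : S => cube b = c).card ≤ V)
    (hstart : ∀ b n ω, ω ∈ B9Thm37Sum.walksFrom nbrs n (cube b) → cube b ∈ cubes (dom b ω))
    {ℓ₀ ℓ₁ : ℝ} (hr : 0 ≤ r)
    (hlen : ∀ b n ω, ω ∈ B9Thm37Sum.walksFrom nbrs n (cube b) → D.dj (dom b ω) ≤ ℓ₀ * n + ℓ₁)
    (hK : 0 ≤ K) (hq : 0 ≤ q) (hDq : Dg * (q * Real.exp (r * ℓ₀)) < 1)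
    (hterm : ∀ b n ω φ, ω ∈ B9Thm37Sum.walksFrom nbrs n (cube b) → φ ∈ sp (dom b ω) → ‖term b ω φ‖ ≤ K * q ^ n) :
    B13.LogHalfBound D sp (Elog nbrs cube dom term) (fun X => (cubes X).card)
      (K * Real.exp (r * ℓ₁) * V / (1 - Dg * (q * Real.exp (r * ℓ₀)))) r := by
  refine logHalfBound_of_walks hD hV hstart (by positivity) (by positivity) hDq fun b n ω φ hω hφ => ?_
  have h1 := hterm b n ω φ hω hφ
  have h2 := hlen b n ω hω
  -- q^n = (q e^{rℓ₀})^n e^{-rℓ₀ n} and e^{-rℓ₀ n} ≤ e^{rℓ₁} e^{-r d}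
  have hexp : (1 : ℝ) ≤ Real.exp (r * ℓ₁) * (Real.exp (r * ℓ₀)) ^ n * Real.exp (-(r * D.dj (dom b ω))) := by
    rw [← Real.exp_nat_mul, ← Real.exp_add, ← Real.exp_add]
    refine Real.one_le_exp ?_
    have : r * D.dj (dom b ω) ≤ r * (ℓ₀ * n + ℓ₁) := mul_le_mul_of_nonneg_left h2 hr
    nlinarith
  calc ‖term b ω φ‖ ≤ K * q ^ n := h1
    _ ≤ K * q ^ n * (Real.exp (r * ℓ₁) * (Real.exp (r * ℓ₀)) ^ n * Real.exp (-(r * D.dj (dom b ω)))) :=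
        le_mul_of_one_le_right (by positivity) hexp
    _ = K * Real.exp (r * ℓ₁) * (q * Real.exp (r * ℓ₀)) ^ n * Real.exp (-(r * D.dj (dom b ω))) := by
        rw [mul_pow]; ring

end walks

/-! ## §3b. Algebra of the shape `LogHalfBound` -/

section shape

variable {D : LocDomainSys} {Φ : Type*} {sp : D.Dom → Set Φ} {E E₁ E₂ : D.Dom → Φ → ℂ} {nX : D.Dom → ℕ}
  {B B₁ B₂ r r₁ r₂ : ℝ}

/-- Monotonicity of the shape in its two constants (larger `B`, smaller rate), using `d ≥ 0`. [folklore] -/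
theorem logHalfBound_mono {B' r' : ℝ} (hB : B ≤ B') (hr : r' ≤ r) (hB' : 0 ≤ B')
    (h : B13.LogHalfBound D sp E nX B r) : B13.LogHalfBound D sp E nX B' r' := by
  intro X φ hφ
  have hd : 0 ≤ D.dj X := D.dj_nonneg X
  have hn : (0 : ℝ) ≤ nX X := Nat.cast_nonneg _
  have hexp : Real.exp (-(r * D.dj X)) ≤ Real.exp (-(r' * D.dj X)) :=
    Real.exp_le_exp.mpr (neg_le_neg (mul_le_mul_of_nonneg_right hr hd))
  calc ‖E X φ‖ ≤ B * nX X * Real.exp (-(r * D.dj X)) := h X φ hφ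
    _ ≤ B' * nX X * Real.exp (-(r * D.dj X)) :=
        mul_le_mul_of_nonneg_right (mul_le_mul_of_nonneg_right hB hn) (Real.exp_pos _).le
    _ ≤ B' * nX X * Real.exp (-(r' * D.dj X)) := mul_le_mul_of_nonneg_left hexp (mul_nonneg hB' hn)

/-- The shape is additive: two localized pieces (the local integral and the series of (63)) with constants `B₁, B₂`
and rates `r₁, r₂` give the sum with `B₁ + B₂` and rate `min r₁ r₂`. [folklore] -/
theorem logHalfBound_add (hB₁ : 0 ≤ B₁) (hB₂ : 0 ≤ B₂) (h₁ : B13.LogHalfBound D sp E₁ nX B₁ r₁)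
    (h₂ : B13.LogHalfBound D sp E₂ nX B₂ r₂) :
    B13.LogHalfBound D sp (fun X φ => E₁ X φ + E₂ X φ) nX (B₁ + B₂) (min r₁ r₂) := by
  have h₁' := logHalfBound_mono le_rfl (min_le_left r₁ r₂) hB₁ h₁
  have h₂' := logHalfBound_mono le_rfl (min_le_right r₁ r₂) hB₂ h₂
  intro X φ hφ
  calc ‖E₁ X φ + E₂ X φ‖ ≤ ‖E₁ X φ‖ + ‖E₂ X φ‖ := norm_add_le _ _
    _ ≤ _ := add_le_add (h₁' X φ hφ) (h₂' X φ hφ)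
    _ = (B₁ + B₂) * nX X * Real.exp (-(min r₁ r₂ * D.dj X)) := by ring

/-- The shape scales: a scalar prefactor `c` (the `½` of (63), coupling-constant powers) multiplies `B` by `‖c‖`.
[folklore] -/
theorem logHalfBound_smul (c : ℂ) (h : B13.LogHalfBound D sp E nX B r) :
    B13.LogHalfBound D sp (fun X φ => c * E X φ) nX (‖c‖ * B) r := by
  intro X φ hφ
  rw [norm_mul, mul_assoc, mul_assoc]
  exact mul_le_mul_of_nonneg_left (by simpa [mul_assoc] using h X φ hφ) (norm_nonneg c)

/-- The difference of two expansions with the same shape (fields `U_{k+1}` and `1`) has the shape with `B₁ + B₂` —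
the CRUDE bound, without the cancellation at `U_{k+1} = 1`; the cancellation is what `logHalfBound_perSite` books.
[folklore] -/
theorem logHalfBound_sub (h₁ : B13.LogHalfBound D sp E₁ nX B₁ r)
    (h₂ : B13.LogHalfBound D sp E₂ nX B₂ r) :
    B13.LogHalfBound D sp (fun X φ => E₁ X φ - E₂ X φ) nX (B₁ + B₂) r := by
  intro X φ hφ
  calc ‖E₁ X φ - E₂ X φ‖ ≤ ‖E₁ X φ‖ + ‖E₂ X φ‖ := norm_sub_le _ _
    _ ≤ _ := add_le_add (h₁ X φ hφ) (h₂ X φ hφ)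
    _ = (B₁ + B₂) * nX X * Real.exp (-(r * D.dj X)) := by ring

end shape


/-! ## §3c. The first term of (63): x-integration of an x-uniform walk bound, and the resummation identity -/

section integrated

variable {D : LocDomainSys} [DecidableEq D.Dom] {Q : Type} [DecidableEq Q] {S : Type} [Fintype S] {Φ : Type*}
  {nbrs : Q → Finset Q} {cube : S → Q} {dom : S → List Q → D.Dom} {cubes : D.Dom → Finset Q} {sp : D.Dom → Set Φ}
  {Dg V : ℕ} {K q r : ℝ}

/-- **The first term of (63), localized**: *"By the above formula this gives an expansion of the last integral in (63)
into a sum of gauge invariant, localized terms"* (p. 272).  If the walk terms of the integrand obey the (23)-type bound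
UNIFORMLY in `x ∈ [0, a]` (`G3WalkBound`, the unprinted input G-IF-10) then the x-integrated terms
`∫₀^a term x b ω dx`, regrouped by localization domain, obey `B13.LogHalfBound` with the same rate and per-cube
constant `a·K·V/(1 − Dg·q)` — the x-uniformity costs exactly the factor `a = 2γ₁`
(`intervalIntegral.norm_integral_le_of_norm_le_const`). [cite: Balaban1985UV3, (63) pp.271–272] -/
theorem logHalfBound_integral63 (hD : ∀ c, (nbrs c).card ≤ Dg)
    (hV : ∀ c : Q, (univ.filter fun b : S => cube b = c).card ≤ V)
    (hstart : ∀ b n ω, ω ∈ B9Thm37Sum.walksFrom nbrs n (cube b) → cube b ∈ cubes (dom b ω))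
    (hK : 0 ≤ K) (hq : 0 ≤ q) (hDq : Dg * q < 1) {a : ℝ} (ha : 0 ≤ a) {term : ℝ → S → List Q → Φ → ℂ}
    (h : G3WalkBound D nbrs cube dom sp term K q r a) :
    B13.LogHalfBound D sp (Elog nbrs cube dom fun b ω φ => ∫ x in (0 : ℝ)..a, term x b ω φ)
      (fun X => (cubes X).card) (a * K * V / (1 - Dg * q)) r := by
  refine logHalfBound_of_walks hD hV hstart (by positivity) hq hDq fun b n ω φ hω hφ => ?_
  have hb : ∀ x ∈ Set.uIoc (0 : ℝ) a, ‖term x b ω φ‖ ≤ K * q ^ n * Real.exp (-(r * D.dj (dom b ω))) := by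
    intro x hx
    rw [uIoc_of_le ha] at hx
    exact h x ⟨hx.1.le, hx.2⟩ b n ω φ hω hφ
  calc ‖∫ x in (0 : ℝ)..a, term x b ω φ‖ ≤ K * q ^ n * Real.exp (-(r * D.dj (dom b ω))) * |a - 0| :=
        intervalIntegral.norm_integral_le_of_norm_le_const hb
    _ = a * K * q ^ n * Real.exp (-(r * D.dj (dom b ω))) := by rw [sub_zero, abs_of_nonneg ha]; ring

omit [Fintype S] in
/-- Regrouping one level: summing the level-`n` parts over ALL localization domains gives back the sum of all `n`-step
walk terms (every walk term has exactly one domain) — *"Summing the expressions with the same localization X"* loses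
nothing. [folklore] -/
theorem sum_level_eq [Fintype S] (term : S → List Q → Φ → ℂ) (n : ℕ) (φ : Φ) :
    ∑ X : D.Dom, level nbrs cube dom term X n φ
      = ∑ b : S, ∑ ω ∈ B9Thm37Sum.walksFrom nbrs n (cube b), term b ω φ := by
  unfold level
  rw [sum_comm]
  exact sum_congr rfl fun b _ => sum_fiberwise (B9Thm37Sum.walksFrom nbrs n (cube b)) (dom b) fun ω => term b ω φ

/-- **The resummation identity**: when every `Elog X` converges (e.g. under the hypotheses of `summable_level`), the sum
of the localized terms over all domains equals the walk expansion summed level by level,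
`Σ_X Elog X = Σ_n Σ_b Σ_{|ω| = n} term b ω` — the identity by which the localized pieces reassemble the (61)/(63)
quantity they came from (its identification with `½∫₀^{2γ₁}dx Tr[…] + Σ_n …` is the walk-representation hypothesis of
the consumer, e.g. `B13.StepData.Repr17`). [folklore] -/
theorem sum_Elog_eq (term : S → List Q → Φ → ℂ) (φ : Φ)
    (hsum : ∀ X : D.Dom, Summable fun n => level nbrs cube dom term X n φ) :
    ∑ X : D.Dom, Elog nbrs cube dom term X φ
      = ∑' n : ℕ, ∑ b : S, ∑ ω ∈ B9Thm37Sum.walksFrom nbrs n (cube b), term b ω φ := by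
  unfold Elog
  rw [← Summable.tsum_finsetSum fun X _ => hsum X]
  exact tsum_congr fun n => sum_level_eq term n φ

end integrated

end Literature.MathematicalPhysics.QuantumFieldTheory.Balaban1983to89.B10LogDet63
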